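import Summits.KontsevichZagierPeriods.KontsevichZagierPeriods.Theses.SymplecticScissors

/-!
# Route SymplecticScissors — `GroupToAreas` (item stmt-KontsevichZagierPeriods-9851)

Planar set-chains are KZ chains: the planar set-chain group
`closure ((domainAddRel ∪ changeOfVariablesRel) ∩ closure {[s] : s planar, integrand 1})`
is contained in `KZ.relations = closure (domainAddRel ∪ integrandAddRel ∪ changeOfVariablesRel ∪
newtonLeibnizRel)`, by monotonicity of `AddSubgroup.closure` (the generating set of the former is
contained in `domainAddRel ∪ changeOfVariablesRel ⊆ relations`). Hence membership of `[r] - [r']`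
in the planar set-chain group gives `KZ.Equivalent r r'`, which is that membership in `relations`
by definition. This is the glue `PlanarK0Injective ⟹ PlanarAreas` of the route.
-/

namespace Summit.KontsevichZagierPeriods.SymplecticScissors

open Literature.NumberTheory.Transcendental

/-- **GroupToAreas** (route SymplecticScissors, item stmt-KontsevichZagierPeriods-9851): if
`[r] - [r']` lies in the planar set-chain group (the subgroup of `KZ.FormalRep` generated by the
domain-additivity and change-of-variables instances that are themselves combinations of planar
integrand-1 representations), then `r` and `r'` are KZ-equivalent. Proof: closure monotonicity —
every generator is a domain-additivity or change-of-variables instance, hence lies in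
`KZ.relations`. -/
theorem groupToAreas_proof :
    Summit.KontsevichZagierPeriods.KontsevichZagierPeriods.Theses.SymplecticScissors.GroupToAreas := by
  unfold Summit.KontsevichZagierPeriods.KontsevichZagierPeriods.Theses.SymplecticScissors.GroupToAreas
  intro r r' h
  unfold KZ.Equivalent
  refine (AddSubgroup.closure_le KZ.relations).2 ?_ h
  intro x hx
  rcases hx.1 with h1 | h2
  · exact KZ.domainAddRel_subset_relations h1
  · exact KZ.changeOfVariablesRel_subset_relations h2

end Summit.KontsevichZagierPeriods.SymplecticScissors
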